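import Literature.NumberTheory.Automorphic.UnitaryGroupArchCenter
import Literature.NumberTheory.Automorphic.UnitaryGroupArchIsotropy

/-!
# The archimedean centre lies in `K_∞` and `κ = ∧²𝔭₊ ⊠ 𝟏` is trivial on it

For `L` CM, `H ∈ M₃(L)` hermitian, `τ : L →+* ℂ` with frame `T` (`Tᴴ τ(H) T = diag(1,1,-1)`), and an archimedean
norm-one unit `y ∈ U(1)(L⁺ ⊗ ℝ)`: the archimedean central element `y · 1₃ ∈ U(H)(L ⊗ ℝ)` (`cmArchCenter`, tree
`UnitaryGroupArchCenter`) projects under `π_τ = archProjU21EmbCM` to the SCALAR `λ · 1₃ ∈ U(2,1)`, `λ = τ(y)`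
(`mat_archProjU21EmbCM_cmArchCenter`, with `archCenterScalar L τ y = τ(y)`), hence fixes the base point of the ball (`cmArchCenter_mem_archIsotropy`:
`y · 1₃ ∈ K_∞`), and the isotropy determinant character takes the value `det(λ·1₃) / λ³ = 1` on it
(`archKappa_cmArchCenter`, `archKappaInv_cmArchCenter`): **the `∧²𝔭₊` character is trivial on the centre** — scalars
act trivially on the ball, so their isotropy representation is the identity. [Helgason 1978, Ch. VIII §7 (isotropy
representation); Borel–Jacquet 1979, §4.1 (archimedean components)]

References: S. Helgason, *Differential Geometry, Lie Groups, and Symmetric Spaces*, Academic Press 1978, Ch. VIII §7;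
A. Borel, H. Jacquet, *Automorphic forms and automorphic representations*, PSPM 33.1 (1979), §4.1.
-/

set_option autoImplicit false

noncomputable section

open NumberField NumberField.mixedEmbedding NumberField.InfinitePlace MulAction

namespace Literature.NumberTheory.Automorphic

namespace UnitaryGroup

open Literature.Geometry.ComplexHyperbolic Literature.Geometry.ComplexHyperbolic.BallModel

variable (L : Type) [Field L] [NumberField L] [IsCMField L] (H : Matrix (Fin 3) (Fin 3) L)
  (τ : L →+* ℂ) (T : GL (Fin 3) ℂ) (hT : formCongr (starRingEnd ℂ) T (H.map τ) = BallModel.J)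

/-- the scalar `λ_τ(y) := τ(y) ∈ ℂ` by which the archimedean centre acts at the embedding `τ`
(`evalEmb τ` of `e(y) ∈ L ⊗ ℝ`). [folklore] -/
def archCenterScalar (y : relNormOneInfUnits (↥(maximalRealSubfield L)) L) : ℂ :=
  evalEmb L τ (isComplex_mk_of_isCMField L τ)
    (InfiniteAdeleRing.ringEquiv_mixedSpace L ((y : (InfiniteAdeleRing L)ˣ) : InfiniteAdeleRing L))

/-- **`π_τ(y · 1₃) = λ_τ(y) · 1₃`**: the archimedean projection of the central element is a scalar matrix
(`T⁻¹ (λ·1) T = λ·1`). [cite: BorelJacquet1979, §4.1] -/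
theorem mat_archProjU21EmbCM_cmArchCenter (y : relNormOneInfUnits (↥(maximalRealSubfield L)) L) :
    mat (archProjU21EmbCM L H τ T hT (cmArchCenter L 3 H y)) =
      archCenterScalar L τ y • (1 : Matrix (Fin 3) (Fin 3) ℂ) := by
  have hX : (((archAtEmb _ L (IsCMField.complexConj L) 3 H τ (isComplex_mk_of_isCMField L τ)
      (complexConj_smul_infinitePlace L _) (IsCMField.complexConj_ne_one L) (cmArchCenter L 3 H y) :
        unitaryGroupOfForm (starRingEnd ℂ) (H.map τ)) : GL (Fin 3) ℂ) : Matrix (Fin 3) (Fin 3) ℂ) =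
      archCenterScalar L τ y • (1 : Matrix (Fin 3) (Fin 3) ℂ) := by
    ext i j
    rw [coe_archAtEmb_apply, cmArchCenter_eq, coe_archCenter, Matrix.smul_apply, Matrix.smul_apply, smul_eq_mul,
      smul_eq_mul, map_mul, archCenterScalar]
    by_cases hij : i = j
    · subst hij; rw [Matrix.one_apply_eq, Matrix.one_apply_eq, map_one]
    · rw [Matrix.one_apply_ne hij, Matrix.one_apply_ne hij, map_zero]
  show (((archProjU21Emb _ L (IsCMField.complexConj L) H τ (isComplex_mk_of_isCMField L τ) T hT
      (complexConj_smul_infinitePlace L _) (IsCMField.complexConj_ne_one L) (cmArchCenter L 3 H y) : U21) :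
        GL (Fin 3) ℂ) : Matrix (Fin 3) (Fin 3) ℂ) = _
  rw [coe_archProjU21Emb_apply, Units.val_mul, Units.val_mul, hX, Matrix.mul_smul, Matrix.mul_one, Matrix.smul_mul,
    Units.inv_mul]

/-- `(y · 1₃)` acts on `(0,0,1)` by the scalar: `W3 (π_τ(y·1₃)) x₀ = λ • (0,0,1)` (private helper). [folklore] -/
private theorem W3_archProjU21EmbCM_cmArchCenter (y : relNormOneInfUnits (↥(maximalRealSubfield L)) L) :
    W3 (archProjU21EmbCM L H τ T hT (cmArchCenter L 3 H y)) x₀ = archCenterScalar L τ y • lift x₀ := by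
  rw [W3, mat_archProjU21EmbCM_cmArchCenter, Matrix.smul_mulVec, Matrix.one_mulVec]

/-- **the archimedean centre lies in `K_∞`**: `y · 1₃ ∈ archIsotropy` (a scalar fixes every point of the ball, in
particular `x₀`). [cite: BorelJacquet1979, §4.1] -/
theorem cmArchCenter_mem_archIsotropy (y : relNormOneInfUnits (↥(maximalRealSubfield L)) L) :
    cmArchCenter L 3 H y ∈ archIsotropy L H τ T hT := by
  rw [mem_archIsotropy_iff]
  refine Ball.ext fun i => ?_
  rw [smul_val, W3_archProjU21EmbCM_cmArchCenter, Pi.smul_apply, smul_eq_mul, x₀_val, Pi.zero_apply]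
  have h0 : lift x₀ (Fin.castSucc i) = 0 := by fin_cases i <;> rfl
  rw [h0, mul_zero, zero_div]

/-- **the archimedean centre as an element of `K_∞`**. [cite: BorelJacquet1979, §4.1] -/
def cmArchCenterIsotropy : relNormOneInfUnits (↥(maximalRealSubfield L)) L →* archIsotropy L H τ T hT :=
  (cmArchCenter L 3 H).codRestrict (archIsotropy L H τ T hT) (cmArchCenter_mem_archIsotropy L H τ T hT)

/-- underlying element of the `K_∞`-valued centre map: `y · 1₃` (the cited construction, coerced). [cite: BorelJacquet1979, §4.1] -/
@[simp] theorem coe_cmArchCenterIsotropy (y : relNormOneInfUnits (↥(maximalRealSubfield L)) L) :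
    ((cmArchCenterIsotropy L H τ T hT y : archIsotropy L H τ T hT) :
        arch (↥(maximalRealSubfield L)) L (IsCMField.complexConj L) 3 H) = cmArchCenter L 3 H y := rfl

/-- the scalar is non-zero (it is the image of a unit; private helper). [folklore] -/
private theorem archCenterScalar_ne_zero (y : relNormOneInfUnits (↥(maximalRealSubfield L)) L) :
    archCenterScalar L τ y ≠ 0 :=
  (Units.map ((evalEmb L τ (isComplex_mk_of_isCMField L τ)).toMonoidHom.comp
      (InfiniteAdeleRing.ringEquiv_mixedSpace L).toRingHom.toMonoidHom) (y : (InfiniteAdeleRing L)ˣ)).ne_zero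

/-- **`κ(y · 1₃) = 1`: the `∧²𝔭₊ ⊠ 𝟏` character is trivial on the archimedean centre** (`det(λ·1₃)/λ³ = 1`).
[cite: Helgason1978, Ch. VIII §7] -/
theorem archKappa_cmArchCenterIsotropy (y : relNormOneInfUnits (↥(maximalRealSubfield L)) L) :
    archKappa L H τ T hT (cmArchCenterIsotropy L H τ T hT y) = 1 := by
  apply Units.ext
  rw [coe_archKappa, Units.val_one, det_Jac, W3_x₀_two]
  show (mat (archProjU21EmbCM L H τ T hT (cmArchCenter L 3 H y))).det /
      mat (archProjU21EmbCM L H τ T hT (cmArchCenter L 3 H y)) 2 2 ^ 3 = 1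
  rw [mat_archProjU21EmbCM_cmArchCenter, Matrix.det_smul, Matrix.det_one, mul_one, Fintype.card_fin,
    Matrix.smul_apply, Matrix.one_apply_eq, smul_eq_mul, mul_one, div_self (pow_ne_zero 3 (archCenterScalar_ne_zero L τ y))]

/-- dual convention: `κ⁻¹(y · 1₃) = 1`. [cite: Helgason1978, Ch. VIII §7] -/
theorem archKappaInv_cmArchCenterIsotropy (y : relNormOneInfUnits (↥(maximalRealSubfield L)) L) :
    archKappaInv L H τ T hT (cmArchCenterIsotropy L H τ T hT y) = 1 := by
  rw [archKappaInv_apply, archKappa_cmArchCenterIsotropy, inv_one]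

/-- **junction with the adelic centre, through `K_∞ → U(H)(𝔸)`**: `archIsotropyToAdelic (y·1₃) = (y,1)·1₃`.
[cite: BorelJacquet1979, §4.1] -/
theorem archIsotropyToAdelic_cmArchCenterIsotropy (y : relNormOneInfUnits (↥(maximalRealSubfield L)) L) :
    archIsotropyToAdelic L H τ T hT (cmArchCenterIsotropy L H τ T hT y) =
      adelicCenter _ L (IsCMField.complexConj L) 3 H
        ((cmAdelicOneEquivRelNormOne L).symm (relNormOneInfToIdeles _ L y)) :=
  archToAdelic_cmArchCenter L 3 H y

end UnitaryGroup

end Literature.NumberTheory.Automorphic
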